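import Literature.NumberTheory.LFunctions.FordProgram1Run26A
import HarnessLib

/-!
# Ford's "Program 1": kernel run 26 (`922 ≤ k ≤ 939`)

Topic `Literature/NumberTheory/LFunctions`. Everything here is PROVED (kernel evaluations, standard
axioms): `FordP1.checkT k = true` for `922 ≤ k ≤ 939`, i.e. the certified re-run of PROGRAM 1 of
K. Ford, Proc. LMS 85 (2002) (the second part of Theorem 3) for these `k` — see `FordProgram1.lean`
for the checker, its soundness `FordP1.row_of_checkK`, and the meaning of the constants
(`ρ = FordP1.rhoOf k / 10⁵`, `θ = FordP1.thetaOf k / 10⁴`, `ω = FordP1.omOf k / 10⁴`). One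
`decide +kernel` per `k` (so that the kernel's evaluation state is bounded by a single run;
`maxHeartbeats 0` lifts the deterministic time-out for each): `931 ≤ k ≤ 939` here, `922 ≤ k ≤ 930`
in the imported `FordProgram1Run26A.lean` (two files of a few minutes of kernel time each); then the
range statement `FordP1.run26` in the `List.all` form consumed by the assembly
`FordTheorem3SmallK.lean` (`FordP1.checkT_of_all run26`).

## References

* K. Ford, Proc. London Math. Soc. (3) 85 (2002), 565–633; arXiv:1910.08209: Theorem 3, (1.7),
  Lemmas 3.4–3.5, Appendix "PROGRAM 1". [Ford2002]
-/

namespace Literature.NumberTheory.LFunctions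
namespace FordP1

set_option maxHeartbeats 0 in
/-- `checkT 931`. [cite: Ford2002, Theorem 3 (second part) and PROGRAM 1] -/
theorem checkT_931 : checkT 931 = true := by
  decide +kernel

set_option maxHeartbeats 0 in
/-- `checkT 932`. [cite: Ford2002, Theorem 3 (second part) and PROGRAM 1] -/
theorem checkT_932 : checkT 932 = true := by
  decide +kernel

set_option maxHeartbeats 0 in
/-- `checkT 933`. [cite: Ford2002, Theorem 3 (second part) and PROGRAM 1] -/
theorem checkT_933 : checkT 933 = true := by
  decide +kernel

set_option maxHeartbeats 0 in
/-- `checkT 934`. [cite: Ford2002, Theorem 3 (second part) and PROGRAM 1] -/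
theorem checkT_934 : checkT 934 = true := by
  decide +kernel

set_option maxHeartbeats 0 in
/-- `checkT 935`. [cite: Ford2002, Theorem 3 (second part) and PROGRAM 1] -/
theorem checkT_935 : checkT 935 = true := by
  decide +kernel

set_option maxHeartbeats 0 in
/-- `checkT 936`. [cite: Ford2002, Theorem 3 (second part) and PROGRAM 1] -/
theorem checkT_936 : checkT 936 = true := by
  decide +kernel

set_option maxHeartbeats 0 in
/-- `checkT 937`. [cite: Ford2002, Theorem 3 (second part) and PROGRAM 1] -/
theorem checkT_937 : checkT 937 = true := by
  decide +kernel

set_option maxHeartbeats 0 in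
/-- `checkT 938`. [cite: Ford2002, Theorem 3 (second part) and PROGRAM 1] -/
theorem checkT_938 : checkT 938 = true := by
  decide +kernel

set_option maxHeartbeats 0 in
/-- `checkT 939`. [cite: Ford2002, Theorem 3 (second part) and PROGRAM 1] -/
theorem checkT_939 : checkT 939 = true := by
  decide +kernel

/-- **Kernel run 26**: `checkT k` for `922 ≤ k ≤ 939`, as `List.all` over `List.range' 922 18`
(assembled from `run26A` and the nine single evaluations above). [cite: Ford2002, Theorem 3
(second part) and PROGRAM 1] -/
theorem run26 : ((List.range' 922 18).all checkT) = true := by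
  rw [List.all_eq_true]
  intro k hk
  rw [List.mem_range'_1] at hk
  obtain ⟨h1, h2⟩ := hk
  rcases Nat.lt_or_ge 930 k with h | h
  swap
  · exact run26A k h1 h
  have h3 : k ≤ 939 := by omega
  clear h1 h2
  interval_cases k
  · exact checkT_931
  · exact checkT_932
  · exact checkT_933
  · exact checkT_934
  · exact checkT_935
  · exact checkT_936
  · exact checkT_937
  · exact checkT_938
  · exact checkT_939

end FordP1
end Literature.NumberTheory.LFunctions
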